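import Summits.NavierStokesRegularity.OSWSelfSimilar.SheetRLinearisedStabilityEven
import Summits.NavierStokesRegularity.OSWSelfSimilar.SheetRSpectrumEvenAssembly
import Summits.NavierStokesRegularity.OSWSelfSimilar.SheetRLinearisedStabilityRecord
import Summits.NavierStokesRegularity.OSWSelfSimilar.SheetRGeneratorBasePoint
import HarnessLib

/-!
# SHEET-ℝ, Z3-SR-SPEC EVEN half: «LINEARLY STABLE MODULO TRANSLATION» FROM THE S2⁺ INTERFACE (point records + far-field datum + one eigenvector
# at `1/2`) — the even twin IN TIER of `SheetRLinearisedStabilityRecord`, ABSTRACT HALF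

HONEST FRAMING (cell ns-blowup GROUP B / zone Z3, case Z3-SR-SPEC EVEN half, HYPOTHESIS-LEDGER v2.4 row (P10)⁺; renewal route of memo
`HOME/profile/cert/cert5/P9-P10-RENEWAL-DESIGN.md` v2; 0 kit; 1-D MODEL certificate frame (viscous gCLM/OSW sheet on the line at `(a, c_l, ε) = (1/5, 1/2, 1)`);
not Euler/NS; «violates: none — MODEL»). NOTHING here asserts that a hypothesis holds, and NOTHING here is interval arithmetic.

`SheetRLinearisedStabilityEven.flow_sub_translationMode_le` (selfsim g16) states the even word modulo three sentences about the Evans function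
`E₁ = evansEven hL K′ h′ ⟪h⁺,·⟫ h⁺ θ` of the perturbed datum: no zero on `{Re σ > −β₀} ∖ {1/2}`, `E₁(1/2) = 0`, `E₁′(1/2) ≠ 0`. This file derives THOSE
three, with `β₀ = 3/100`, from EXACTLY the hypothesis list of selfsim g14's abstract even spectral word `SheetRSpectrumEvenAssembly.eigen_set_eq_singleton`
(cert-2 g10's `SheetRSpectrumEvenPointAssembly.eq_half_of_pointDataE` instantiated with `J := resolventEven`): two (S1⁺) data `h` (centre, `3/20 ≤ m`) and
`h′` (perturbed, `−m′ < −3/100`), `‖θ‖ ≤ 4`, the conjugation symmetry of `E`, the (P8⁺) allowance `‖E₁ − E‖ ≤ pert ≤ 1107/200000` on `Re ≥ −3/100`,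
implementation 2's `PointDataE (resolventEven hL K h) h⁺ h⁺ θ E` (or implementation 1's `PointDataEA`), the far-field datum
`MixedFarDatum (resolventEven hL K h) h⁺ h⁺ 1 …` with its four literals, and ONE eigenvector `v ≠ 0` of `T⁺* + θ⟪h⁺,·⟫h⁺` at `σ = 1/2` (PO⁺: the translation
mode) — `evansEven_sentences_of_pointDataE` / `…_of_pointDataEA`; and it restates the word on that interface:
* `flow_sub_translationMode_le_of_pointDataE` — for the (P9)⁺ generator data `S`, `S_F` at the perturbed datum (`SheetRLinearisedSemigroupEven`) and
  `h⁺ ∈ D(T⁺*)`: **∀ 0 < β′ < 3/100 ∃ M ∀ δ₀ ∀ t ≥ 0, ‖S_F(t)δ₀ − (θ⟪h⁺, R⁺*(1/2)δ₀⟫/E₁′(1/2))·e^{t/2}•R⁺*(1/2)h⁺‖ ≤ M‖δ₀‖e^{−β′t}**;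
* `exists_flow_sub_translationMode_le_of_pointDataE` — existence form: `S`, `S_F` PRODUCED by `exists_c0SemigroupE` / `exists_c0Semigroup_fullE` (selfsim g15).
PRICE PAID HONESTLY: at this abstract tier the two data `h`, `h′` are related only through `pert`, so the domain sentence `h⁺ ∈ D(T⁺*)` at the PERTURBED
datum is ONE explicit binder (`mem_domain_generatorEven_of_mixedFarDatum` discharges it only when the flow and the far-field datum share the datum); for
the lift of record it is cert-lane regularity. The composition with the even spectral word OF RECORD (frame `L = 8`, `SheetRSpectrumEvenEndToEnd` /
`SheetRSpectrumEvenOfRecord`, discharging `hc`, `hcs`, `hu`, `hhE`, `hhw` and the eigenvector by `translationMode_of_record`) is NOT made here (cert lane).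
WHAT THIS IS NOT: not NS; no interval arithmetic; no number of record moves; no definition, no named fact.
-/

noncomputable section

namespace Summit.NavierStokesRegularity.OSWSelfSimilar
namespace SheetRLinearisedStabilityEvenRecord

open _root_.MeasureTheory _root_.Set _root_.Filter _root_.Complex SheetREnergySpace SheetRComplexPivot SheetREvenEnergySpace SheetREvenForms
  SheetREvenClass SheetRResolventEvenClass SheetRGeneratorEvenWeak SheetREvansEven SheetRLinearisedSemigroup SheetRLinearisedSemigroupEven
  SheetRSpectrumStepRule SheetRSpectrumEvenWindingLists SheetRSpectrumEvenPointCertificate SheetRSpectrumEvenPointAssembly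
  SheetRSpectrumEvenPointCertificateA SheetRSpectrumEvenPointAssemblyA SheetRSpectrumEvenAssembly SheetRLinearisedStabilityEven
  SheetRGeneratorBasePoint Literature.Analysis.OperatorTheory Literature.Analysis.UnboundedOperators
open scoped Topology NNReal ComplexConjugate InnerProductSpace

variable {L D₀ D₁ V₀ c m D₀' D₁' V₀' c' m' : ℝ} {d V d' V' : ℝ → ℝ}

variable (hL : 0 < L) [CompleteSpace (WcevenZ hL)] (K : EspE L hL →L[ℝ] W L) (h : GardingDataKE L hL d V K D₀ D₁ V₀ c m)
  (K' : EspE L hL →L[ℝ] W L) (h' : GardingDataKE L hL d' V' K' D₀' D₁' V₀' c' m')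

/-! ### §1 The three even Evans sentences at `1/2` from the S2⁺ interface (`β₀ = 3/100`) -/

omit [CompleteSpace (WcevenZ hL)] in
/-- `−3/100 < Re σ` gives `ra ≤ Re σ` (`ra = −3/100`). [folklore] -/
theorem ra_le_re_of_lt {σ : ℂ} (hσ : -((3 : ℝ) / 100) < σ.re) : ra ≤ σ.re := by
  rw [ra]; linarith

/-- **The three even Evans sentences from the S2⁺ interface** (`β₀ = 3/100`, implementation 2's point records): under EXACTLY the hypotheses of
`SheetRSpectrumEvenAssembly.eigen_set_eq_singleton` — `E₁ ≠ 0` on `{Re σ > −3/100} ∖ {1/2}`, `E₁ (1/2) = 0`, `E₁′(1/2) ≠ 0` for the Evans function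
`E₁ = evansEven hL K′ h′ ⟪h⁺,·⟫ h⁺ θ` of the perturbed datum. MODEL; not NS; nothing is asserted to hold. [folklore] -/
theorem evansEven_sentences_of_pointDataE (hm : (3 : ℝ) / 20 ≤ m) (hm' : -m' < ra) (hv : WcevenZ hL) (θ : ℂ) (hθ : ‖θ‖ ≤ 4)
    (hsym : ∀ w, evansEven hL K h (innerSL ℂ hv) hv θ (conj w) = conj (evansEven hL K h (innerSL ℂ hv) hv θ w))
    {pert : ℝ} (hpert : ∀ w : ℂ, ra ≤ w.re →
      ‖evansEven hL K' h' (innerSL ℂ hv) hv θ w - evansEven hL K h (innerSL ℂ hv) hv θ w‖ ≤ pert) (hpert' : pert ≤ (1107 : ℝ) / 200000)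
    (hP : PointDataE (resolventEven hL K h) hv hv θ (evansEven hL K h (innerSL ℂ hv) hv θ))
    (hF : MixedFarDatum (resolventEven hL K h) hv hv 1 ((10075811313 : ℝ) / 10000000000) ((754639259 : ℝ) / 200000000)
      ((1011518153 : ℝ) / 250000000) ((4049925993 : ℝ) / 1000000000))
    {v : WcevenZ hL} (hv0 : v ≠ 0)
    (hv1 : ∃ hu : v ∈ (generatorEven hL K' h' ((1 : ℂ) / 2) (lt_trans hm' ra_lt_half_re)).domain,
      generatorEven hL K' h' ((1 : ℂ) / 2) (lt_trans hm' ra_lt_half_re) ⟨v, hu⟩ = ((1 : ℂ) / 2) • v - (θ * innerSL ℂ hv v) • hv) :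
    (∀ σ : ℂ, -((3 : ℝ) / 100) < σ.re → σ ≠ 1 / 2 → evansEven hL K' h' (innerSL ℂ hv) hv θ σ ≠ 0) ∧
      evansEven hL K' h' (innerSL ℂ hv) hv θ (1 / 2) = 0 ∧ deriv (evansEven hL K' h' (innerSL ℂ hv) hv θ) (1 / 2) ≠ 0 := by
  obtain ⟨hJ, hU, hb, hE⟩ := dictionary hL K h hm hv θ
  have hhalf := evansEven_half_eq_zero hL K' h' hm' hv θ hv0 hv1
  obtain ⟨honly, horder⟩ := eq_half_of_pointDataE hJ hU hm hb hE hθ hsym hpert hpert' hP hF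
    (analyticOnNhd_evansEven_rectE hL K' h' hm' _ hv θ) hhalf
  refine ⟨fun σ hσ hσ1 hE0 => hσ1 (honly σ (ra_le_re_of_lt hσ) hE0), hhalf, ?_⟩
  exact SheetRLinearisedStabilityRecord.deriv_ne_zero_of_order_one
    (analyticOnNhd_evansEven hL K' h' (innerSL ℂ hv) hv θ ((1 : ℂ) / 2) (lt_trans hm' ra_lt_half_re)) hhalf horder

/-- **The three even Evans sentences from IMPLEMENTATION 1's point balls** (`PointDataEA`, cert-2 g10 `eq_half_of_pointDataEA`): as
`evansEven_sentences_of_pointDataE` with `PointDataEA` in place of `PointDataE`. MODEL; not NS. [folklore] -/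
theorem evansEven_sentences_of_pointDataEA (hm : (3 : ℝ) / 20 ≤ m) (hm' : -m' < ra) (hv : WcevenZ hL) (θ : ℂ) (hθ : ‖θ‖ ≤ 4)
    (hsym : ∀ w, evansEven hL K h (innerSL ℂ hv) hv θ (conj w) = conj (evansEven hL K h (innerSL ℂ hv) hv θ w))
    {pert : ℝ} (hpert : ∀ w : ℂ, ra ≤ w.re →
      ‖evansEven hL K' h' (innerSL ℂ hv) hv θ w - evansEven hL K h (innerSL ℂ hv) hv θ w‖ ≤ pert) (hpert' : pert ≤ (1107 : ℝ) / 200000)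
    (hP : PointDataEA (resolventEven hL K h) hv hv θ (evansEven hL K h (innerSL ℂ hv) hv θ))
    (hF : MixedFarDatum (resolventEven hL K h) hv hv 1 ((10075811313 : ℝ) / 10000000000) ((754639259 : ℝ) / 200000000)
      ((1011518153 : ℝ) / 250000000) ((4049925993 : ℝ) / 1000000000))
    {v : WcevenZ hL} (hv0 : v ≠ 0)
    (hv1 : ∃ hu : v ∈ (generatorEven hL K' h' ((1 : ℂ) / 2) (lt_trans hm' ra_lt_half_re)).domain,
      generatorEven hL K' h' ((1 : ℂ) / 2) (lt_trans hm' ra_lt_half_re) ⟨v, hu⟩ = ((1 : ℂ) / 2) • v - (θ * innerSL ℂ hv v) • hv) :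
    (∀ σ : ℂ, -((3 : ℝ) / 100) < σ.re → σ ≠ 1 / 2 → evansEven hL K' h' (innerSL ℂ hv) hv θ σ ≠ 0) ∧
      evansEven hL K' h' (innerSL ℂ hv) hv θ (1 / 2) = 0 ∧ deriv (evansEven hL K' h' (innerSL ℂ hv) hv θ) (1 / 2) ≠ 0 := by
  obtain ⟨hJ, hU, hb, hE⟩ := dictionary hL K h hm hv θ
  have hhalf := evansEven_half_eq_zero hL K' h' hm' hv θ hv0 hv1
  obtain ⟨honly, horder⟩ := eq_half_of_pointDataEA hJ hU hm hb hE hθ hsym hpert hpert' hP hF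
    (analyticOnNhd_evansEven_rectE hL K' h' hm' _ hv θ) hhalf
  refine ⟨fun σ hσ hσ1 hE0 => hσ1 (honly σ (ra_le_re_of_lt hσ) hE0), hhalf, ?_⟩
  exact SheetRLinearisedStabilityRecord.deriv_ne_zero_of_order_one
    (analyticOnNhd_evansEven hL K' h' (innerSL ℂ hv) hv θ ((1 : ℂ) / 2) (lt_trans hm' ra_lt_half_re)) hhalf horder

/-! ### §2 The word on the S2⁺ interface -/

/-- **«LINEARLY STABLE MODULO TRANSLATION» (MODEL) ON THE S2⁺ INTERFACE.** Hypotheses: the two (S1⁺) data `h` (centre, `3/20 ≤ m`) and `h′`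
(perturbed, `−m′ < −3/100`); the S2⁺ interface of `SheetRSpectrumEvenAssembly.eigen_set_eq_singleton` (`‖θ‖ ≤ 4`, conjugation symmetry, the allowance
`pert ≤ 1107/200000`, `PointDataE`, `MixedFarDatum`, one eigenvector `v ≠ 0` at `1/2`); the (P9)⁺ generator data of `exists_c0SemigroupE` /
`exists_c0Semigroup_fullE` on a pair `S`, `S_F` AT THE PERTURBED DATUM; and `h⁺ ∈ D(T⁺*)`. Then ∀ `0 < β′ < 3/100` ∃ `M` ∀ `δ₀` ∀ `t ≥ 0`:
`‖S_F(t)δ₀ − (θ⟪h⁺, R⁺*(1/2)δ₀⟫/E₁′(1/2))·e^{t/2}•R⁺*(1/2)h⁺‖ ≤ M‖δ₀‖e^{−β′t}`. 1-D MODEL; NOT NS; nothing is asserted to hold. [folklore] -/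
theorem flow_sub_translationMode_le_of_pointDataE (hm : (3 : ℝ) / 20 ≤ m) (hm' : -m' < ra) (hv : WcevenZ hL) (θ : ℂ) (hθ : ‖θ‖ ≤ 4)
    (hsym : ∀ w, evansEven hL K h (innerSL ℂ hv) hv θ (conj w) = conj (evansEven hL K h (innerSL ℂ hv) hv θ w))
    {pert : ℝ} (hpert : ∀ w : ℂ, ra ≤ w.re →
      ‖evansEven hL K' h' (innerSL ℂ hv) hv θ w - evansEven hL K h (innerSL ℂ hv) hv θ w‖ ≤ pert) (hpert' : pert ≤ (1107 : ℝ) / 200000)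
    (hP : PointDataE (resolventEven hL K h) hv hv θ (evansEven hL K h (innerSL ℂ hv) hv θ))
    (hF : MixedFarDatum (resolventEven hL K h) hv hv 1 ((10075811313 : ℝ) / 10000000000) ((754639259 : ℝ) / 200000000)
      ((1011518153 : ℝ) / 250000000) ((4049925993 : ℝ) / 1000000000))
    {v : WcevenZ hL} (hv0 : v ≠ 0)
    (hv1 : ∃ hu : v ∈ (generatorEven hL K' h' ((1 : ℂ) / 2) (lt_trans hm' ra_lt_half_re)).domain,
      generatorEven hL K' h' ((1 : ℂ) / 2) (lt_trans hm' ra_lt_half_re) ⟨v, hu⟩ = ((1 : ℂ) / 2) • v - (θ * innerSL ℂ hv v) • hv)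
    {σ₀ : ℂ} (hσ₀ : -m' < σ₀.re) (S SF : C0Semigroup ℂ (WcevenZ hL))
    (hS : S.generator = generatorEven hL K' h' σ₀ hσ₀) (hSM : ∀ τ : ℝ≥0, ‖S.app τ‖ ≤ Real.exp (-m' * τ))
    (hlap : ∀ σ : ℂ, -m' < σ.re → ∀ G : WcevenZ hL, S.laplaceResolventFun σ G = resolventEven hL K' h' σ G)
    (hdomF : (SF.generator.domain : Set (WcevenZ hL)) = (generatorEven hL K' h' σ₀ hσ₀).domain)
    (hgenF : ∀ (u : WcevenZ hL) (hu : u ∈ (generatorEven hL K' h' σ₀ hσ₀).domain), ∃ hu' : u ∈ SF.generator.domain,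
      SF.generator ⟨u, hu'⟩ = generatorEven hL K' h' σ₀ hσ₀ ⟨u, hu⟩ + (θ * innerSL ℂ hv u) • hv)
    (hf : hv ∈ (generatorEven hL K' h' σ₀ hσ₀).domain)
    {β' : ℝ} (hβ' : 0 < β') (hβ'3 : β' < (3 : ℝ) / 100) :
    ∃ M : ℝ, ∀ (δ₀ : WcevenZ hL) (t : ℝ), 0 ≤ t →
      ‖SF.app t.toNNReal δ₀ -
        ((deriv (evansEven hL K' h' (innerSL ℂ hv) hv θ) (1 / 2))⁻¹ * (θ * innerSL ℂ hv (resolventEven hL K' h' (1 / 2) δ₀)) *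
            (Real.exp (t / 2) : ℂ)) • resolventEven hL K' h' (1 / 2) hv‖ ≤ M * ‖δ₀‖ * Real.exp (-β' * t) := by
  obtain ⟨hzero, hEhalf, hE'half⟩ :=
    evansEven_sentences_of_pointDataE hL K h K' h' hm hm' hv θ hθ hsym hpert hpert' hP hF hv0 hv1
  have hm3 : (3 : ℝ) / 100 ≤ m' := by rw [ra] at hm'; linarith
  have hm0 : 0 < m' := by linarith
  exact flow_sub_translationMode_le hL K' h' hσ₀ hm0 (innerSL ℂ hv) hv θ S SF hS hSM hlap hdomF hgenF hf
    (β₀ := (3 : ℝ) / 100) (by norm_num) hm3 hβ' hβ'3 hzero hEhalf hE'half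

/-- **THE LINEARISED EVEN FLOW EXISTS AND IS LINEARLY STABLE MODULO TRANSLATION (MODEL)** — existence form: the two (P9)⁺ semigroups are PRODUCED
(`exists_c0SemigroupE` / `exists_c0Semigroup_fullE` under the (S1⁺) datum `h′` alone; unique by `C0Semigroup.eq_of_generator_eq`) and the word of
`flow_sub_translationMode_le_of_pointDataE` holds for them. Hypotheses = the two (S1⁺) data, the S2⁺ interface (point records of implementation 2,
far-field datum, allowance, symmetry, one eigenvector at `1/2`) and `h⁺ ∈ D(T⁺*)` (base point `1/2`; the domain does not depend on the base point,
`SheetRGeneratorBasePoint.generatorEven_domain_eq`). 1-D MODEL; NOT NS; nothing is asserted to hold. [folklore] -/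
theorem exists_flow_sub_translationMode_le_of_pointDataE (hm : (3 : ℝ) / 20 ≤ m) (hm' : -m' < ra) (hv : WcevenZ hL) (θ : ℂ)
    (hθ : ‖θ‖ ≤ 4)
    (hsym : ∀ w, evansEven hL K h (innerSL ℂ hv) hv θ (conj w) = conj (evansEven hL K h (innerSL ℂ hv) hv θ w))
    {pert : ℝ} (hpert : ∀ w : ℂ, ra ≤ w.re →
      ‖evansEven hL K' h' (innerSL ℂ hv) hv θ w - evansEven hL K h (innerSL ℂ hv) hv θ w‖ ≤ pert) (hpert' : pert ≤ (1107 : ℝ) / 200000)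
    (hP : PointDataE (resolventEven hL K h) hv hv θ (evansEven hL K h (innerSL ℂ hv) hv θ))
    (hF : MixedFarDatum (resolventEven hL K h) hv hv 1 ((10075811313 : ℝ) / 10000000000) ((754639259 : ℝ) / 200000000)
      ((1011518153 : ℝ) / 250000000) ((4049925993 : ℝ) / 1000000000))
    {v : WcevenZ hL} (hv0 : v ≠ 0)
    (hv1 : ∃ hu : v ∈ (generatorEven hL K' h' ((1 : ℂ) / 2) (lt_trans hm' ra_lt_half_re)).domain,
      generatorEven hL K' h' ((1 : ℂ) / 2) (lt_trans hm' ra_lt_half_re) ⟨v, hu⟩ = ((1 : ℂ) / 2) • v - (θ * innerSL ℂ hv v) • hv)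
    (hf : hv ∈ (generatorEven hL K' h' ((1 : ℂ) / 2) (lt_trans hm' ra_lt_half_re)).domain)
    {β' : ℝ} (hβ' : 0 < β') (hβ'3 : β' < (3 : ℝ) / 100) :
    ∃ (S SF : C0Semigroup ℂ (WcevenZ hL)) (hσ₀ : -m' < (((‖(θ • innerSL ℂ hv).smulRight hv‖ : ℝ) : ℂ)).re),
      S.generator = generatorEven hL K' h' _ hσ₀ ∧ (∀ τ : ℝ≥0, ‖S.app τ‖ ≤ Real.exp (-m' * τ)) ∧
      (∀ σ : ℂ, -m' < σ.re → ∀ G : WcevenZ hL, S.laplaceResolventFun σ G = resolventEven hL K' h' σ G) ∧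
      ((SF.generator.domain : Set (WcevenZ hL)) = (generatorEven hL K' h' _ hσ₀).domain) ∧
      (∀ (u : WcevenZ hL) (hu : u ∈ (generatorEven hL K' h' _ hσ₀).domain), ∃ hu' : u ∈ SF.generator.domain,
        SF.generator ⟨u, hu'⟩ = generatorEven hL K' h' _ hσ₀ ⟨u, hu⟩ + (θ * innerSL ℂ hv u) • hv) ∧
      ∃ M : ℝ, ∀ (δ₀ : WcevenZ hL) (t : ℝ), 0 ≤ t →
        ‖SF.app t.toNNReal δ₀ -
          ((deriv (evansEven hL K' h' (innerSL ℂ hv) hv θ) (1 / 2))⁻¹ * (θ * innerSL ℂ hv (resolventEven hL K' h' (1 / 2) δ₀)) *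
              (Real.exp (t / 2) : ℂ)) • resolventEven hL K' h' (1 / 2) hv‖ ≤ M * ‖δ₀‖ * Real.exp (-β' * t) := by
  have hm0 : 0 < m' := by
    have : ra < 0 := by norm_num [ra]
    linarith
  set b : ℝ := ‖(θ • innerSL ℂ hv).smulRight hv‖ with hb
  have hσ₀b : b - m' < ((b : ℂ)).re := by simp; linarith
  obtain ⟨hσ₀, SF, -, -, hdomF, hgenF⟩ := exists_c0Semigroup_fullE hL K' h' (innerSL ℂ hv) hv θ (b := b) le_rfl hσ₀b
  obtain ⟨S, hSM, hlap, hS⟩ := exists_c0SemigroupE hL K' h' hσ₀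
  have hf' : hv ∈ (generatorEven hL K' h' _ hσ₀).domain := by
    rw [generatorEven_domain_eq hL K' h' hσ₀ (lt_trans hm' ra_lt_half_re)]; exact hf
  obtain ⟨M, hM⟩ := flow_sub_translationMode_le_of_pointDataE hL K h K' h' hm hm' hv θ hθ hsym hpert hpert' hP hF hv0 hv1 hσ₀ S SF
    hS hSM hlap hdomF hgenF hf' hβ' hβ'3
  exact ⟨S, SF, hσ₀, hS, hSM, hlap, hdomF, hgenF, M, hM⟩

end SheetRLinearisedStabilityEvenRecord
end Summit.NavierStokesRegularity.OSWSelfSimilar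

end
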